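import Mathlib
import Summits.Langlands.Langlands.Theses.CapacityClassicality
import Summits.Langlands.Langlands.Theorems.CapacityClassicalityCongruenceToClassical
import Summits.Langlands.Langlands.Theorems.CapacityClassicalityIntegralOverconvergentIsCongruence

/-!
# Route CapacityClassicality — β′ conditionally on Sturm's bound and unbounded denominators
(crux stmt-Langlands-8927, line Sketch, skeleton v5)

`EigenIntegralOverconvergentIsClassical` (β′: an `𝓞_E`-integral, archimedean-radius-one,
Katz-overconvergent `q`-expansion of integer weight `k` with `a 1 = 1` which is exactly `T_ℓ`-eigen
in `q`-expansion form for every prime `ℓ ∤ N p` is the `q`-expansion of a classical modular form of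
weight `k` on some `Γ₁(M)`) follows from

* α = `IntegralOverconvergentIsCongruence` via the landed glue
  `Summit.Langlands.Langlands.Theorems.congruenceToClassical_proof` (item stmt-Langlands-10367,
  Mathlib only: the `T_ℓ`-eigen quotient `F / Δ ^ m` is bounded at every cusp), and
* α holds conditionally on Sturm's congruence bound mod `p` for `Γ₁(N)` and on the unbounded
  denominators theorem of Calegari–Dimitrov–Tang, by the landed conditional assembly
  `integralOverconvergentIsCongruence_of_sturm_of_unboundedDenominators` (item stmt-Langlands-8457).

Composing the two gives β′ CONDITIONALLY on the same two published theorems, both vendored as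
Literature named facts and not yet proved in Lean:
`Literature.NumberTheory.ModularForms.Sturm1987_congruenceBound_Gamma1_modPrime` (Sturm 1987,
Thm 1) and `Literature.NumberTheory.Automorphic.CalegariDimitrovTang2025_unboundedDenominators_algInt`
(Calegari–Dimitrov–Tang 2025, Thm 1 with Remarks 58/59).  The item stays open until both facts are
discharged; this file is the conditional closing theorem of the crux.
-/

set_option linter.dupNamespace false -- project-wide option (lakefile weak.linter.dupNamespace); `Summit.Langlands.Langlands` is the mandated namespace

namespace Summit.Langlands.Langlands.Theorems.CapacityClassicality

/-- **β′ (`EigenIntegralOverconvergentIsClassical`), conditionally on Sturm's congruence bound and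
the unbounded denominators theorem.**  If Sturm's congruence bound mod `p` holds for cusp forms on
`Γ₁(N)` with integer coefficients (`Sturm1987_congruenceBound_Gamma1_modPrime`, Sturm 1987 Thm 1)
and the unbounded denominators theorem holds for finite-index modular forms with algebraic-integer
coefficients (`CalegariDimitrovTang2025_unboundedDenominators_algInt`, Calegari–Dimitrov–Tang 2025,
Thm 1 and Remarks 58/59), then every `𝓞_E`-integral, archimedean-radius-one, Katz-overconvergent,
normalised, exactly tame-Hecke-eigen `q`-expansion of integer weight `k` is the `q`-expansion of a
classical modular form of weight `k` on some `Γ₁(M)`.  Proof: α from the two facts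
(`integralOverconvergentIsCongruence_of_sturm_of_unboundedDenominators`), then α → β′
(`congruenceToClassical_proof`). -/
theorem eigenIntegralOverconvergentIsClassical_of_sturm_of_unboundedDenominators
    (hSturm : Literature.NumberTheory.ModularForms.Sturm1987_congruenceBound_Gamma1_modPrime)
    (hCDT : Literature.NumberTheory.Automorphic.CalegariDimitrovTang2025_unboundedDenominators_algInt) :
    Summit.Langlands.Langlands.Theses.CapacityClassicality.EigenIntegralOverconvergentIsClassical := by
  have hαβ := Summit.Langlands.Langlands.Theorems.congruenceToClassical_proof
  unfold Summit.Langlands.Langlands.Theses.CapacityClassicality.CongruenceToClassical at hαβ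
  exact hαβ (integralOverconvergentIsCongruence_of_sturm_of_unboundedDenominators hSturm hCDT)

end Summit.Langlands.Langlands.Theorems.CapacityClassicality
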